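import Mathlib
import Literature.NumberTheory.Transcendental.SchanuelEclEmptyProofs
import Literature.Barriers.Schanuel.AlgebraicIndependenceOfLogarithms
import Summits.Schanuel.Schanuel.Theses.RootDecomp1D

/-!
# RootDecomp1D — flag-split glue (lens-3 gen 2, node v3 «PeriodFlagSplit»)

Proves the two glue items of the in-place splits of route-Schanuel-RootDecomp1D (rev 1–3, 2026-08-30):
`schanuelAtBakerPeriodsGlue_holds` (stmt-Schanuel-26559: `AlgIndepLogs → BakerPeriodsOverLogFields →
SchanuelAtBakerPeriods`, closing engine E2 at `(𝓛, 𝓑)` from `S|𝓛 ⟸ AIL`) and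
`relSchanuelOverBakerFieldsGlue_holds` (stmt-Schanuel-26539: `InhomBakerOverBakerFields →
SchanuelOverInhomBakerFields → RelSchanuelOverBakerFields`, transitivity E1 = defect additivity along
`𝓑 ≤ 𝓛⋆ ≤ ℂ`). §0 folklore `trdeg` bookkeeping; §1 the generic nested-sector engine on `ℚ`-subspaces
`E ≤ E' ≤ E''` of `ℂ` (Kirby's `GL_n(ℚ)` bookkeeping [cite: Kirby2010, §3]); §4 dictionary `S|𝓛 ↔ AIL`;
then the items. Sector predicates and the flag spaces `𝓛 = span_ℚ{l : e^l ∈ ℚ̄}`, `𝓑 = span_ℚ{β·l}`,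
`𝓛⋆ = span_ℚ(ℚ̄ ∪ {β·l})` are written out verbatim as in the route file (this file defines nothing).
Port of the lens-3 hand-off `HOME/decomp-schanuel-lens-3/v3/prover/RootDecomp1DFlagSplit.port.lean`
(critic CLEARED the node 2026-08-30T03:14:58Z) by the census seat; 0 sorry. Port note: never `rw` with the
`ℚ`-instantiated generic `trdeg` lemmas (instance diamond); use `calc`/`exact`.
-/

set_option linter.dupNamespace false

noncomputable section

open Complex IntermediateField

namespace Summit.Schanuel.Schanuel.Theorems.RootDecomp1DFlagSplit

open Summit.Schanuel.Schanuel.Theses.RootDecomp1D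

/-! ### §0 Folklore tools -/
set_option synthInstance.maxHeartbeats 400000 in
/-- The tower law along `K ⊆ K(S) ⊆ K(S)(T) = K(S ∪ T)` as an equality. [folklore] -/
theorem trdeg_adjoin_union_eq_add {K E : Type*} [Field K] [Field E] [Algebra K E] (S T : Set E) :
    Algebra.trdeg K (adjoin K (S ∪ T)) =
      Algebra.trdeg K (adjoin K S) + Algebra.trdeg (adjoin K S) (adjoin (adjoin K S) T) := by
  have htower := trdeg_add_eq K (adjoin K S) (A := adjoin (adjoin K S) T)
  have heq : Algebra.trdeg K (adjoin (adjoin K S) T) = Algebra.trdeg K (adjoin K (S ∪ T)) := by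
    rw [← (equivOfEq (adjoin_adjoin_left K S T)).trdeg_eq]
    rfl
  rw [← heq, htower]

/-- `trdeg_F F(S) ≤ #S`. [folklore] -/
theorem trdeg_adjoin_le_cardinalMk {F E : Type*} [Field F] [Field E] [Algebra F E] (S : Set E) :
    Algebra.trdeg F ↥(adjoin F S) ≤ Cardinal.mk S := by
  haveI := Literature.NumberTheory.Transcendental.isAlgebraic_adjoin_over_algebraAdjoin (F := F) S
  exact (Algebra.IsAlgebraic.trdeg_le_cardinalMk F (((↑) : adjoin F S → E) ⁻¹' S)).trans
    (Cardinal.mk_preimage_of_injective _ _ Subtype.val_injective)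

/-- `trdeg ℚ ℚ(y, e^y)` is finite for a finite tuple `y`. [folklore] -/
theorem trdeg_gens_lt_aleph0 {k : ℕ} (y : Fin k → ℂ) :
    Algebra.trdeg ℚ ↥(adjoin ℚ (Set.range y ∪ Set.range (cexp ∘ y))) < Cardinal.aleph0 := by
  refine lt_of_le_of_lt (trdeg_adjoin_le_cardinalMk _) ?_
  rw [Cardinal.lt_aleph0_iff_set_finite]
  exact (Set.finite_range y).union (Set.finite_range _)

/-- Relative `↔` difference count: `m ≤ trdeg_{ℚ(G)} ℚ(G)(S) ↔ trdeg ℚ(G) + m ≤ trdeg ℚ(G ∪ S)`. [folklore] -/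
theorem rel_iff_add (G S : Set ℂ)
    (hG : Algebra.trdeg ℚ ↥(adjoin ℚ G) < Cardinal.aleph0) (m : ℕ) :
    (m : Cardinal) ≤ Algebra.trdeg ↥(adjoin ℚ G) ↥(adjoin ↥(adjoin ℚ G) S) ↔
      Algebra.trdeg ℚ ↥(adjoin ℚ G) + m ≤ Algebra.trdeg ℚ ↥(adjoin ℚ (G ∪ S)) := by
  -- (the two `Algebra ℚ ↥(adjoin ℚ G)` instance paths are only defeq, so we argue by `calc`, not `rw`)
  have htower : Algebra.trdeg ℚ ↥(adjoin ℚ (G ∪ S)) =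
      Algebra.trdeg ℚ ↥(adjoin ℚ G) + Algebra.trdeg ↥(adjoin ℚ G) ↥(adjoin ↥(adjoin ℚ G) S) :=
    trdeg_adjoin_union_eq_add (K := ℚ) G S
  obtain ⟨c, hc⟩ := Cardinal.lt_aleph0.1 hG
  constructor
  · intro h
    calc Algebra.trdeg ℚ ↥(adjoin ℚ G) + (m : Cardinal)
        ≤ Algebra.trdeg ℚ ↥(adjoin ℚ G) + Algebra.trdeg ↥(adjoin ℚ G) ↥(adjoin ↥(adjoin ℚ G) S) :=
          add_le_add le_rfl h
      _ = Algebra.trdeg ℚ ↥(adjoin ℚ (G ∪ S)) := htower.symm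
  · intro h
    have h' : (m : Cardinal) + (c : Cardinal) ≤
        Algebra.trdeg ↥(adjoin ℚ G) ↥(adjoin ↥(adjoin ℚ G) S) + (c : Cardinal) := by
      calc (m : Cardinal) + (c : Cardinal) = Algebra.trdeg ℚ ↥(adjoin ℚ G) + (m : Cardinal) := by
            rw [hc, add_comm]
        _ ≤ Algebra.trdeg ℚ ↥(adjoin ℚ (G ∪ S)) := h
        _ = Algebra.trdeg ℚ ↥(adjoin ℚ G) +
              Algebra.trdeg ↥(adjoin ℚ G) ↥(adjoin ↥(adjoin ℚ G) S) := htower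
        _ = Algebra.trdeg ↥(adjoin ℚ G) ↥(adjoin ↥(adjoin ℚ G) S) + (c : Cardinal) := by
            rw [hc, add_comm]
    exact (Cardinal.add_nat_le_add_nat_iff c).1 h'




/-- Ranges of an appended family. [folklore] -/
theorem range_comp_append {α : Type*} {a b : ℕ} (φ : ℂ → α) (f : Fin a → ℂ) (g : Fin b → ℂ) :
    Set.range (φ ∘ fun t : Fin (a + b) => Sum.elim f g (finSumFinEquiv.symm t)) =
      Set.range (φ ∘ f) ∪ Set.range (φ ∘ g) := by
  have h : (φ ∘ fun t : Fin (a + b) => Sum.elim f g (finSumFinEquiv.symm t)) =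
      Sum.elim (φ ∘ f) (φ ∘ g) ∘ ⇑finSumFinEquiv.symm := by
    funext t
    simp only [Function.comp_apply]
    rcases finSumFinEquiv.symm t with i | j <;> rfl
  rw [h, finSumFinEquiv.symm.surjective.range_comp, Set.Sum.elim_range]

/-- Ranges of an appended family (no post-composition). [folklore] -/
theorem range_append {a b : ℕ} (f : Fin a → ℂ) (g : Fin b → ℂ) :
    Set.range (fun t : Fin (a + b) => Sum.elim f g (finSumFinEquiv.symm t)) =
      Set.range f ∪ Set.range g := by
  simpa using range_comp_append (id : ℂ → ℂ) f g

open Submodule in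
/-- A tuple linearly independent modulo `E` spans a subspace disjoint from `E`. [folklore] -/
theorem disjoint_span_of_linearIndependent_mkQ {m : ℕ} (E : Submodule ℚ ℂ) {z : Fin m → ℂ}
    (hz : LinearIndependent ℚ (E.mkQ ∘ z)) : Disjoint (span ℚ (Set.range z)) E := by
  rw [disjoint_def]
  intro a ha haE
  obtain ⟨c, rfl⟩ := (Submodule.mem_span_range_iff_exists_fun ℚ).1 ha
  have h0 : ∑ i, c i • (E.mkQ ∘ z) i = 0 := by
    have : E.mkQ (∑ i, c i • z i) = 0 := (Submodule.Quotient.mk_eq_zero E).2 haE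
    simpa [map_sum, map_smul] using this
  have hc : ∀ i, c i = 0 := Fintype.linearIndependent_iff.1 hz c h0
  simp [hc]


/-! ### §1 The generic nested-sector engine (`ℚ`-subspaces `E ≤ E'` of `ℂ`) -/

open Submodule in
/-- **(E2) closing** `S|E → Rel(E'|E) → S|E'`: split `span x̄ = (span x̄ ∩ E) ⊕ U`, clear denominators,
count inside by `S|E` and the complement relatively by `Rel(E'|E)`, tower law (Kirby's `GL_n(ℚ)` bookkeeping). -/
theorem schanuelOn_of_relOn {E E' : Submodule ℚ ℂ}
    (hA : (∀ (k : ℕ) (y : Fin k → ℂ), (∀ i, y i ∈ E) → LinearIndependent ℚ y →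
      (k : Cardinal) ≤ Algebra.trdeg ℚ ↥(adjoin ℚ (Set.range y ∪ Set.range (cexp ∘ y)))))
    (hB : (∀ (k m : ℕ) (y : Fin k → ℂ) (z : Fin m → ℂ), (∀ i, y i ∈ E) → (∀ j, z j ∈ E') →
      LinearIndependent ℚ ((E).mkQ ∘ z) →
      (m : Cardinal) ≤ Algebra.trdeg ↥(adjoin ℚ (Set.range y ∪ Set.range (cexp ∘ y)))
        ↥(adjoin ↥(adjoin ℚ (Set.range y ∪ Set.range (cexp ∘ y)))
          (Set.range z ∪ Set.range (cexp ∘ z))))) :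
    (∀ (k : ℕ) (y : Fin k → ℂ), (∀ i, y i ∈ E') → LinearIndependent ℚ y →
      (k : Cardinal) ≤ Algebra.trdeg ℚ ↥(adjoin ℚ (Set.range y ∪ Set.range (cexp ∘ y)))) := by
  intro n x hxE' hx
  set V : Submodule ℚ ℂ := span ℚ (Set.range x) with hV
  haveI : FiniteDimensional ℚ V := FiniteDimensional.span_of_finite ℚ (Set.finite_range x)
  have hVE' : V ≤ E' := span_le.mpr (Set.range_subset_iff.mpr hxE')
  set W : Submodule ℚ ℂ := V ⊓ E with hW
  obtain ⟨U', hU'⟩ := W.exists_isCompl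
  set U : Submodule ℚ ℂ := V ⊓ U' with hU
  haveI : FiniteDimensional ℚ W := Submodule.finiteDimensional_of_le inf_le_left
  haveI : FiniteDimensional ℚ U := Submodule.finiteDimensional_of_le inf_le_left
  have hWU_sup : W ⊔ U = V := by
    rw [hU, inf_comm, ← sup_inf_assoc_of_le U' (inf_le_left : W ≤ V), hU'.sup_eq_top, top_inf_eq]
  have hWU_disj : Disjoint W U := hU'.disjoint.mono_right inf_le_right
  have hUE_disj : Disjoint U E := by
    rw [disjoint_def]
    intro a haU haE
    exact (disjoint_def.mp hWU_disj) a ⟨inf_le_left (b := U') haU, haE⟩ haU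
  -- dimensions
  set k := Module.finrank ℚ W
  set m := Module.finrank ℚ U
  have hn : k + m = n := by
    have h1 := Submodule.finrank_sup_add_finrank_inf_eq W U
    rw [hWU_disj.eq_bot, finrank_bot, add_zero, hWU_sup] at h1
    rw [← h1, hV, finrank_span_eq_card hx, Fintype.card_fin]
  -- bases
  let bW := Module.finBasis ℚ W
  let bU := Module.finBasis ℚ U
  let y : Fin k → ℂ := fun i => (bW i : ℂ)
  let z : Fin m → ℂ := fun j => (bU j : ℂ)
  have hy_mem : ∀ i, y i ∈ E := fun i => ((bW i).2 : (bW i : ℂ) ∈ V ⊓ E).2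
  have hy_V : ∀ i, y i ∈ V := fun i => ((bW i).2 : (bW i : ℂ) ∈ V ⊓ E).1
  have hz_U : ∀ j, z j ∈ U := fun j => (bU j).2
  have hz_V : ∀ j, z j ∈ V := fun j => inf_le_left (b := U') (hz_U j)
  have hy_li : LinearIndependent ℚ y := bW.linearIndependent.map' W.subtype W.ker_subtype
  have hz_li : LinearIndependent ℚ z := bU.linearIndependent.map' U.subtype U.ker_subtype
  -- clearing denominators
  choose Ny hNy hNy_mem using fun i =>
    Literature.NumberTheory.Transcendental.exists_nsmul_mem_span_int x (hy_V i)
  choose Nz hNz hNz_mem using fun j =>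
    Literature.NumberTheory.Transcendental.exists_nsmul_mem_span_int x (hz_V j)
  let cy : Fin k → ℚˣ := fun i => Units.mk0 (Ny i : ℚ) (Nat.cast_ne_zero.mpr (hNy i))
  let cz : Fin m → ℚˣ := fun j => Units.mk0 (Nz j : ℚ) (Nat.cast_ne_zero.mpr (hNz j))
  let y' : Fin k → ℂ := fun i => (Ny i : ℚ) • y i
  let z' : Fin m → ℂ := fun j => (Nz j : ℚ) • z j
  have hy'_eq : cy • y = y' := by
    funext i; simp only [Pi.smul_apply', cy, y', Units.smul_def, Units.val_mk0]
  have hz'_eq : cz • z = z' := by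
    funext j; simp only [Pi.smul_apply', cz, z', Units.smul_def, Units.val_mk0]
  have hy'_li : LinearIndependent ℚ y' := hy'_eq ▸ hy_li.units_smul cy
  have hz'_li : LinearIndependent ℚ z' := hz'_eq ▸ hz_li.units_smul cz
  have hy'_mem : ∀ i, y' i ∈ E := fun i => E.smul_mem _ (hy_mem i)
  have hz'_U : ∀ j, z' j ∈ U := fun j => U.smul_mem _ (hz_U j)
  have hz'_E' : ∀ j, z' j ∈ E' := fun j => hVE' (V.smul_mem _ (hz_V j))
  have hz'_modE : LinearIndependent ℚ (E.mkQ ∘ z') := by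
    refine hz'_li.map ?_
    rw [ker_mkQ]
    exact hUE_disj.mono_left (span_le.mpr (Set.range_subset_iff.mpr hz'_U))
  -- the field-theoretic estimate
  set Sz := Set.range z' ∪ Set.range (cexp ∘ z') with hSz
  set Sy := Set.range y' ∪ Set.range (cexp ∘ y') with hSy
  set Ky := adjoin ℚ Sy with hKy
  have hk : (k : Cardinal) ≤ Algebra.trdeg ℚ Ky := hA k y' hy'_mem hy'_li
  have hm : (m : Cardinal) ≤ Algebra.trdeg Ky (adjoin Ky Sz) := hB k m y' z' hy'_mem hz'_E' hz'_modE
  have hkm : (k : Cardinal) + m ≤ Algebra.trdeg ℚ (adjoin ℚ (Sy ∪ Sz)) :=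
    Literature.NumberTheory.Transcendental.add_le_trdeg_adjoin_union Sy Sz hk hm
  -- comparison with `ℚ(x̄, e^{x̄})`
  set Kx := adjoin ℚ (Set.range x ∪ Set.range (cexp ∘ x)) with hKx
  have hle : adjoin ℚ (Sy ∪ Sz) ≤ Kx := by
    rw [adjoin_le_iff]
    rintro a ((⟨i, rfl⟩ | ⟨i, rfl⟩) | (⟨j, rfl⟩ | ⟨j, rfl⟩))
    · exact (Literature.NumberTheory.Transcendental.mem_adjoin_of_mem_span_int x (hNy_mem i)).1
    · exact (Literature.NumberTheory.Transcendental.mem_adjoin_of_mem_span_int x (hNy_mem i)).2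
    · exact (Literature.NumberTheory.Transcendental.mem_adjoin_of_mem_span_int x (hNz_mem j)).1
    · exact (Literature.NumberTheory.Transcendental.mem_adjoin_of_mem_span_int x (hNz_mem j)).2
  calc (n : Cardinal) = (k : Cardinal) + m := by rw [← hn, Nat.cast_add]
    _ ≤ Algebra.trdeg ℚ (adjoin ℚ (Sy ∪ Sz)) := hkm
    _ ≤ Algebra.trdeg ℚ Kx :=
        trdeg_le_of_injective (IntermediateField.inclusion hle) (IntermediateField.inclusion_injective hle)

open Submodule in
/-- **(E1) transitivity along a flag** `E ≤ E' → Rel(E'|E) → Rel(E''|E') → Rel(E''|E)`: split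
`span x̄ = (span x̄ ∩ E') ⊕ U` over the base `ℚ(y, e^y)`; defects are ADDITIVE along the flag. -/
theorem relOn_trans {E E' E'' : Submodule ℚ ℂ} (hEE' : E ≤ E')
    (h1 : (∀ (k m : ℕ) (y : Fin k → ℂ) (z : Fin m → ℂ), (∀ i, y i ∈ E) → (∀ j, z j ∈ E') →
      LinearIndependent ℚ ((E).mkQ ∘ z) →
      (m : Cardinal) ≤ Algebra.trdeg ↥(adjoin ℚ (Set.range y ∪ Set.range (cexp ∘ y)))
        ↥(adjoin ↥(adjoin ℚ (Set.range y ∪ Set.range (cexp ∘ y)))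
          (Set.range z ∪ Set.range (cexp ∘ z)))))
    (h2 : (∀ (k m : ℕ) (y : Fin k → ℂ) (z : Fin m → ℂ), (∀ i, y i ∈ E') → (∀ j, z j ∈ E'') →
      LinearIndependent ℚ ((E').mkQ ∘ z) →
      (m : Cardinal) ≤ Algebra.trdeg ↥(adjoin ℚ (Set.range y ∪ Set.range (cexp ∘ y)))
        ↥(adjoin ↥(adjoin ℚ (Set.range y ∪ Set.range (cexp ∘ y)))
          (Set.range z ∪ Set.range (cexp ∘ z))))) :
    (∀ (k m : ℕ) (y : Fin k → ℂ) (z : Fin m → ℂ), (∀ i, y i ∈ E) → (∀ j, z j ∈ E'') →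
      LinearIndependent ℚ ((E).mkQ ∘ z) →
      (m : Cardinal) ≤ Algebra.trdeg ↥(adjoin ℚ (Set.range y ∪ Set.range (cexp ∘ y)))
        ↥(adjoin ↥(adjoin ℚ (Set.range y ∪ Set.range (cexp ∘ y)))
          (Set.range z ∪ Set.range (cexp ∘ z)))) := by
  classical
  intro k n y x hy hxE'' hxmod
  have hx : LinearIndependent ℚ x := LinearIndependent.of_comp E.mkQ hxmod
  have hVE : Disjoint (span ℚ (Set.range x)) E := disjoint_span_of_linearIndependent_mkQ E hxmod
  have hfin : Algebra.trdeg ℚ ↥(adjoin ℚ (Set.range y ∪ Set.range (cexp ∘ y))) <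
      Cardinal.aleph0 := trdeg_gens_lt_aleph0 y
  rw [rel_iff_add _ _ hfin n]
  -- split `V = span x̄` as `W ⊕ U`, `W = V ∩ E'`
  set V : Submodule ℚ ℂ := span ℚ (Set.range x) with hV
  haveI : FiniteDimensional ℚ V := FiniteDimensional.span_of_finite ℚ (Set.finite_range x)
  have hVE'' : V ≤ E'' := span_le.mpr (Set.range_subset_iff.mpr hxE'')
  set W : Submodule ℚ ℂ := V ⊓ E' with hW
  obtain ⟨U', hU'⟩ := W.exists_isCompl
  set U : Submodule ℚ ℂ := V ⊓ U' with hU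
  haveI : FiniteDimensional ℚ W := Submodule.finiteDimensional_of_le inf_le_left
  haveI : FiniteDimensional ℚ U := Submodule.finiteDimensional_of_le inf_le_left
  have hWU_sup : W ⊔ U = V := by
    rw [hU, inf_comm, ← sup_inf_assoc_of_le U' (inf_le_left : W ≤ V), hU'.sup_eq_top, top_inf_eq]
  have hWU_disj : Disjoint W U := hU'.disjoint.mono_right inf_le_right
  have hUE'_disj : Disjoint U E' := by
    rw [disjoint_def]
    intro a haU haE
    exact (disjoint_def.mp hWU_disj) a ⟨inf_le_left (b := U') haU, haE⟩ haU
  set a := Module.finrank ℚ W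
  set b := Module.finrank ℚ U
  have hn : a + b = n := by
    have h1 := Submodule.finrank_sup_add_finrank_inf_eq W U
    rw [hWU_disj.eq_bot, finrank_bot, add_zero, hWU_sup] at h1
    rw [← h1, hV, finrank_span_eq_card hx, Fintype.card_fin]
  let bW := Module.finBasis ℚ W
  let bU := Module.finBasis ℚ U
  let w : Fin a → ℂ := fun i => (bW i : ℂ)
  let u : Fin b → ℂ := fun j => (bU j : ℂ)
  have hw_E' : ∀ i, w i ∈ E' := fun i => ((bW i).2 : (bW i : ℂ) ∈ V ⊓ E').2
  have hw_V : ∀ i, w i ∈ V := fun i => ((bW i).2 : (bW i : ℂ) ∈ V ⊓ E').1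
  have hu_U : ∀ j, u j ∈ U := fun j => (bU j).2
  have hu_V : ∀ j, u j ∈ V := fun j => inf_le_left (b := U') (hu_U j)
  have hw_li : LinearIndependent ℚ w := bW.linearIndependent.map' W.subtype W.ker_subtype
  have hu_li : LinearIndependent ℚ u := bU.linearIndependent.map' U.subtype U.ker_subtype
  -- clearing denominators
  choose Nw hNw hNw_mem using fun i =>
    Literature.NumberTheory.Transcendental.exists_nsmul_mem_span_int x (hw_V i)
  choose Nu hNu hNu_mem using fun j =>
    Literature.NumberTheory.Transcendental.exists_nsmul_mem_span_int x (hu_V j)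
  let cw : Fin a → ℚˣ := fun i => Units.mk0 (Nw i : ℚ) (Nat.cast_ne_zero.mpr (hNw i))
  let cu : Fin b → ℚˣ := fun j => Units.mk0 (Nu j : ℚ) (Nat.cast_ne_zero.mpr (hNu j))
  let w' : Fin a → ℂ := fun i => (Nw i : ℚ) • w i
  let u' : Fin b → ℂ := fun j => (Nu j : ℚ) • u j
  have hw'_eq : cw • w = w' := by
    funext i; simp only [Pi.smul_apply', cw, w', Units.smul_def, Units.val_mk0]
  have hu'_eq : cu • u = u' := by
    funext j; simp only [Pi.smul_apply', cu, u', Units.smul_def, Units.val_mk0]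
  have hw'_li : LinearIndependent ℚ w' := hw'_eq ▸ hw_li.units_smul cw
  have hu'_li : LinearIndependent ℚ u' := hu'_eq ▸ hu_li.units_smul cu
  have hw'_E' : ∀ i, w' i ∈ E' := fun i => E'.smul_mem _ (hw_E' i)
  have hw'_V : ∀ i, w' i ∈ V := fun i => V.smul_mem _ (hw_V i)
  have hu'_U : ∀ j, u' j ∈ U := fun j => U.smul_mem _ (hu_U j)
  have hu'_E'' : ∀ j, u' j ∈ E'' := fun j => hVE'' (V.smul_mem _ (hu_V j))
  have hw'_modE : LinearIndependent ℚ (E.mkQ ∘ w') := by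
    refine hw'_li.map ?_
    rw [ker_mkQ]
    exact hVE.mono_left (span_le.mpr (Set.range_subset_iff.mpr hw'_V))
  have hu'_modE' : LinearIndependent ℚ (E'.mkQ ∘ u') := by
    refine hu'_li.map ?_
    rw [ker_mkQ]
    exact hUE'_disj.mono_left (span_le.mpr (Set.range_subset_iff.mpr hu'_U))
  -- first layer, base `y`
  have h1' := (rel_iff_add _ _ hfin a).1 (h1 k a y w' hy hw'_E' hw'_modE)
  -- second layer, base `(y, w')`
  let yw : Fin (k + a) → ℂ := fun t => Sum.elim y w' (finSumFinEquiv.symm t)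
  have hyw_E' : ∀ t, yw t ∈ E' := by
    intro t
    change Sum.elim y w' (finSumFinEquiv.symm t) ∈ E'
    rcases finSumFinEquiv.symm t with i | j
    · exact hEE' (hy i)
    · exact hw'_E' j
  have hfin2 := trdeg_gens_lt_aleph0 yw
  have h2' := (rel_iff_add _ _ hfin2 b).1 (h2 (k + a) b yw u' hyw_E' hu'_E'' hu'_modE')
  have hGyw : Set.range yw ∪ Set.range (cexp ∘ yw) =
      (Set.range y ∪ Set.range (cexp ∘ y)) ∪ (Set.range w' ∪ Set.range (cexp ∘ w')) := by
    have e1 : Set.range yw = Set.range y ∪ Set.range w' := range_append y w'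
    have e2 : Set.range (cexp ∘ yw) = Set.range (cexp ∘ y) ∪ Set.range (cexp ∘ w') :=
      range_comp_append cexp y w'
    rw [e1, e2, Set.union_union_union_comm]
  rw [hGyw] at h2'
  -- the top field sits inside `ℚ(y, e^y)(x̄, e^{x̄})` written over `ℚ`
  have hx' : adjoin ℚ (Set.range x ∪ Set.range (cexp ∘ x)) ≤
      adjoin ℚ ((Set.range y ∪ Set.range (cexp ∘ y)) ∪ (Set.range x ∪ Set.range (cexp ∘ x))) :=
    adjoin.mono _ _ _ Set.subset_union_right
  have hle : adjoin ℚ (((Set.range y ∪ Set.range (cexp ∘ y)) ∪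
      (Set.range w' ∪ Set.range (cexp ∘ w'))) ∪ (Set.range u' ∪ Set.range (cexp ∘ u'))) ≤
      adjoin ℚ ((Set.range y ∪ Set.range (cexp ∘ y)) ∪ (Set.range x ∪ Set.range (cexp ∘ x))) := by
    rw [adjoin_le_iff]
    rintro c ((hc | (⟨i, rfl⟩ | ⟨i, rfl⟩)) | (⟨j, rfl⟩ | ⟨j, rfl⟩))
    · exact subset_adjoin ℚ _ (Or.inl hc)
    · exact hx' (Literature.NumberTheory.Transcendental.mem_adjoin_of_mem_span_int x (hNw_mem i)).1
    · exact hx' (Literature.NumberTheory.Transcendental.mem_adjoin_of_mem_span_int x (hNw_mem i)).2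
    · exact hx' (Literature.NumberTheory.Transcendental.mem_adjoin_of_mem_span_int x (hNu_mem j)).1
    · exact hx' (Literature.NumberTheory.Transcendental.mem_adjoin_of_mem_span_int x (hNu_mem j)).2
  calc Algebra.trdeg ℚ ↥(adjoin ℚ (Set.range y ∪ Set.range (cexp ∘ y))) + (n : Cardinal)
      = Algebra.trdeg ℚ ↥(adjoin ℚ (Set.range y ∪ Set.range (cexp ∘ y))) + (a : Cardinal) +
          (b : Cardinal) := by rw [← hn, Nat.cast_add, add_assoc]
    _ ≤ Algebra.trdeg ℚ ↥(adjoin ℚ ((Set.range y ∪ Set.range (cexp ∘ y)) ∪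
          (Set.range w' ∪ Set.range (cexp ∘ w')))) + (b : Cardinal) := add_le_add h1' le_rfl
    _ ≤ Algebra.trdeg ℚ ↥(adjoin ℚ (((Set.range y ∪ Set.range (cexp ∘ y)) ∪
          (Set.range w' ∪ Set.range (cexp ∘ w'))) ∪ (Set.range u' ∪ Set.range (cexp ∘ u')))) := h2'
    _ ≤ _ := trdeg_le_of_injective (IntermediateField.inclusion hle) (IntermediateField.inclusion_injective hle)

/-! ### §4 Dictionary: the pieces ARE the engine's sectors on the flag -/
/-- P1 `↔ S|𝓛` (logarithms have algebraic exponentials, so `trdeg ℚ(l, e^l) = trdeg ℚ(l)`). -/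
theorem schanuelOn_logs_iff_algIndepLogs :
    (∀ (k : ℕ) (y : Fin k → ℂ), (∀ i, y i ∈ Submodule.span ℚ {z : ℂ | IsAlgebraic ℚ (Complex.exp z)}) →
      LinearIndependent ℚ y →
      (k : Cardinal) ≤ Algebra.trdeg ℚ ↥(adjoin ℚ (Set.range y ∪ Set.range (cexp ∘ y)))) ↔ AlgIndepLogs := by
  constructor
  · intro h n l halg hli
    have hmem : ∀ i, l i ∈ Submodule.span ℚ {z : ℂ | IsAlgebraic ℚ (Complex.exp z)} := fun i =>
      Submodule.subset_span (halg i)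
    have hT : ∀ x ∈ Set.range (cexp ∘ l), IsAlgebraic ℚ x := by
      rintro _ ⟨i, rfl⟩
      exact halg i
    exact Literature.Barriers.Schanuel.algebraicIndependent_of_le_trdeg_adjoin l
      ((h n l hmem hli).trans_eq (Literature.Barriers.Schanuel.trdeg_adjoin_union_eq_of_isAlgebraic _ _ hT))
  · intro h k y hy hli
    -- `e^z ∈ ℚ̄` on span 𝓛 (= tree `isAlgebraic_exp_of_mem_span`, module without farm olean; local, not re-declared)
    have hexp : ∀ z ∈ Submodule.span ℚ {z : ℂ | IsAlgebraic ℚ (Complex.exp z)},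
        IsAlgebraic ℚ (Complex.exp z) := by
      intro z hz
      induction hz using Submodule.span_induction with
      | mem x hx => exact hx
      | zero => rw [Complex.exp_zero]; exact isAlgebraic_one
      | add a b _ _ ha hb => rw [Complex.exp_add]; exact ha.mul hb
      | smul q a _ ha =>
        have hpow : Complex.exp (q • a) ^ q.den = Complex.exp a ^ q.num := by
          rw [← Complex.exp_nat_mul, ← Complex.exp_int_mul, Rat.smul_def, ← mul_assoc]
          congr 2
          exact_mod_cast congrArg (Rat.cast : ℚ → ℂ) (Rat.den_mul_eq_num q)
        refine IsAlgebraic.of_pow q.den_pos ?_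
        rw [hpow]
        cases q.num with
        | ofNat k => rw [Int.ofNat_eq_natCast, zpow_natCast]; exact ha.pow k
        | negSucc k => rw [zpow_negSucc]; exact (ha.pow (k + 1)).inv
    have halg : ∀ i, IsAlgebraic ℚ (Complex.exp (y i)) := fun i => hexp _ (hy i)
    have hAI : AlgebraicIndependent ℚ y := h k y halg hli
    set K := adjoin ℚ (Set.range y ∪ Set.range (cexp ∘ y)) with hK
    let x : Fin k → K := fun i => ⟨y i, subset_adjoin ℚ _ (Or.inl ⟨i, rfl⟩)⟩
    have hx : AlgebraicIndependent ℚ x := AlgebraicIndependent.of_comp K.val hAI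
    simpa using hx.cardinalMk_le_trdeg

/-- Item stmt-Schanuel-26559 (glue of the split of `SchanuelAtBakerPeriods`, stmt-Schanuel-24885):
`P1 → P2 → A`, engine E2 at `(𝓛, 𝓑)` from `S|𝓛 ⟸ AIL` (item bodies = the inlined sector predicates, `rfl`). -/
theorem schanuelAtBakerPeriodsGlue_holds : SchanuelAtBakerPeriodsGlue := fun h1 h2 =>
  schanuelOn_of_relOn (E := Submodule.span ℚ {z : ℂ | IsAlgebraic ℚ (Complex.exp z)})
    (E' := Submodule.span ℚ {z : ℂ | ∃ β l : ℂ, IsAlgebraic ℚ β ∧ IsAlgebraic ℚ (Complex.exp l) ∧ z = β * l})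
    (schanuelOn_logs_iff_algIndepLogs.mpr h1) h2

/-- Item stmt-Schanuel-26539 (glue of the split of `RelSchanuelOverBakerFields`, stmt-Schanuel-24886):
`P3 → P4 → B`, transitivity E1 along `𝓑 ≤ 𝓛⋆ ≤ ⊤` (items over `⊤` omit the vacuous membership hypothesis). -/
theorem relSchanuelOverBakerFieldsGlue_holds : RelSchanuelOverBakerFieldsGlue := fun h3 h4 =>
  fun k m y z hy hz =>
    relOn_trans (E := Submodule.span ℚ {z : ℂ | ∃ β l : ℂ, IsAlgebraic ℚ β ∧ IsAlgebraic ℚ (Complex.exp l) ∧ z = β * l})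
      (E' := Submodule.span ℚ ({z : ℂ | IsAlgebraic ℚ z} ∪ {z : ℂ | ∃ β l : ℂ, IsAlgebraic ℚ β ∧ IsAlgebraic ℚ (Complex.exp l) ∧ z = β * l}))
      (E'' := ⊤) (Submodule.span_mono Set.subset_union_right) h3
      (fun k m y z hy _ hz => h4 k m y z hy hz) k m y z hy (fun _ => Submodule.mem_top) hz

end Summit.Schanuel.Schanuel.Theorems.RootDecomp1DFlagSplit
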